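import Mathlib
import Summits.Ventures.PercRepro2.HCov
import Summits.Ventures.PercRepro2.PendantRoot
import Summits.Ventures.PercRepro2.RootLeafOCells

/-!
# A ROOT as a leaf at `b`, part 2: the fifteen cells of the pattern of `(o, a₂, a₃, b)`
(blind cell PercRepro2, p4 g2; S3 (G4-b), proofs/P4-ROOTLEAF-B.md)

The `(b, a₂)`-world needs the sixth connection `a₃ ↔ b` (the side of `a₃` relative to `C(b)`),
so the thirteen cells of `RootLeafOCells` are refined to the fifteen pattern atoms of the four
marks: `stateVec6 ω = (o↔a₂, o↔a₃, a₂↔a₃, o↔b, a₂↔b, a₃↔b)`, `consistent6` = the 15 transitivity-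
consistent states, and `prob_eq_sum_cells6 : prob M = ∑_{v ∈ consistent6.filter φ} prob (cell6 v)`
for every event whose membership is a Boolean function `φ` of the six connections.
-/

namespace Summit.Ventures.PercRepro2

open UnionCluster CovForm PendantRoot

namespace RootLeafB

variable {V : Type*} {E : Type*} [Fintype E] [DecidableEq E] {R : Type*} [CommRing R]

/-- A state of the six connections `(o↔a₂, o↔a₃, a₂↔a₃, o↔b, a₂↔b, a₃↔b)`. -/
abbrev B6 := Bool × Bool × Bool × Bool × Bool × Bool

section Cells

variable [Fintype V] [DecidableEq V] (ends : E → Sym2 V) (o a₂ a₃ b : V)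

/-- The six-connection state vector of a configuration. -/
def stateVec6 (ω : Config E) : B6 :=
  (decide (Conn ends ω o a₂), decide (Conn ends ω o a₃), decide (Conn ends ω a₂ a₃),
    decide (Conn ends ω o b), decide (Conn ends ω a₂ b), decide (Conn ends ω a₃ b))

/-- The cell of a six-connection state. -/
def cell6 (v : B6) : Set (Config E) := {ω | stateVec6 ends o a₂ a₃ b ω = v}

/-- The fifteen consistent states (= the set partitions of the four marks). -/
def consistent6 : Finset B6 :=
  {(false, false, false, false, false, false),
    (false, false, false, false, false, true),
    (false, false, false, false, true, false),
    (false, false, false, true, false, false),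
    (false, false, true, false, false, false),
    (false, false, true, false, true, true),
    (false, false, true, true, false, false),
    (false, true, false, false, false, false),
    (false, true, false, false, true, false),
    (false, true, false, true, false, true),
    (true, false, false, false, false, false),
    (true, false, false, false, false, true),
    (true, false, false, true, true, false),
    (true, true, true, false, false, false),
    (true, true, true, true, true, true)}

omit [DecidableEq E] in
/-- Every configuration has a consistent six-connection state. -/
lemma stateVec6_mem_consistent6 (ω : Config E) : stateVec6 ends o a₂ a₃ b ω ∈ consistent6 := by
  have t1 : Conn ends ω o a₂ → Conn ends ω o a₃ → Conn ends ω a₂ a₃ :=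
    fun h1 h2 => conn_trans (conn_symm h1) h2
  have t2 : Conn ends ω o a₂ → Conn ends ω a₂ a₃ → Conn ends ω o a₃ := fun h1 h2 => conn_trans h1 h2
  have t3 : Conn ends ω o a₃ → Conn ends ω a₂ a₃ → Conn ends ω o a₂ :=
    fun h1 h2 => conn_trans h1 (conn_symm h2)
  have t4 : Conn ends ω o a₂ → Conn ends ω o b → Conn ends ω a₂ b :=
    fun h1 h2 => conn_trans (conn_symm h1) h2
  have t5 : Conn ends ω o a₂ → Conn ends ω a₂ b → Conn ends ω o b := fun h1 h2 => conn_trans h1 h2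
  have t6 : Conn ends ω o b → Conn ends ω a₂ b → Conn ends ω o a₂ :=
    fun h1 h2 => conn_trans h1 (conn_symm h2)
  have t7 : Conn ends ω o a₃ → Conn ends ω o b → Conn ends ω a₃ b :=
    fun h1 h2 => conn_trans (conn_symm h1) h2
  have t8 : Conn ends ω o a₃ → Conn ends ω a₃ b → Conn ends ω o b := fun h1 h2 => conn_trans h1 h2
  have t9 : Conn ends ω o b → Conn ends ω a₃ b → Conn ends ω o a₃ :=
    fun h1 h2 => conn_trans h1 (conn_symm h2)
  have t10 : Conn ends ω a₂ a₃ → Conn ends ω a₂ b → Conn ends ω a₃ b :=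
    fun h1 h2 => conn_trans (conn_symm h1) h2
  have t11 : Conn ends ω a₂ a₃ → Conn ends ω a₃ b → Conn ends ω a₂ b := fun h1 h2 => conn_trans h1 h2
  have t12 : Conn ends ω a₂ b → Conn ends ω a₃ b → Conn ends ω a₂ a₃ :=
    fun h1 h2 => conn_trans h1 (conn_symm h2)
  simp only [stateVec6, consistent6, Finset.mem_insert, Finset.mem_singleton, Prod.mk.injEq]
  by_cases c1 : Conn ends ω o a₂ <;> by_cases c2 : Conn ends ω o a₃ <;>
    by_cases c3 : Conn ends ω a₂ a₃ <;> by_cases c4 : Conn ends ω o b <;>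
    by_cases c5 : Conn ends ω a₂ b <;> by_cases c6 : Conn ends ω a₃ b <;> simp_all

omit [DecidableEq E] in
/-- Distinct cells are disjoint. -/
lemma disjoint_cell6 {v w : B6} (hvw : v ≠ w) :
    Disjoint (cell6 ends o a₂ a₃ b v) (cell6 ends o a₂ a₃ b w) := by
  rw [Set.disjoint_left]
  intro ω hv hw
  exact hvw (hv.symm.trans hw)

variable (p : E → R)

/-- **Cell decomposition** (fifteen cells). -/
theorem prob_eq_sum_cells6 (M : Set (Config E)) (φ : B6 → Bool)
    (hM : ∀ ω, ω ∈ M ↔ φ (stateVec6 ends o a₂ a₃ b ω) = true) :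
    prob p M =
      ∑ v ∈ consistent6.filter (fun v => φ v = true), prob p (cell6 ends o a₂ a₃ b v) := by
  have hMeq : M = ⋃ v ∈ consistent6.filter (fun v => φ v = true), cell6 ends o a₂ a₃ b v := by
    ext ω
    simp only [Set.mem_iUnion, Finset.mem_filter, exists_prop, cell6, Set.mem_setOf_eq]
    constructor
    · intro h
      exact ⟨_, ⟨stateVec6_mem_consistent6 ends o a₂ a₃ b ω, (hM ω).1 h⟩, rfl⟩
    · rintro ⟨v, ⟨_, hφ⟩, hv⟩
      exact (hM ω).2 (hv ▸ hφ)
  rw [hMeq, RootLeafO.prob_biUnion]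
  intro v _ w _ hvw
  exact disjoint_cell6 ends o a₂ a₃ b hvw

end Cells

end RootLeafB

end Summit.Ventures.PercRepro2
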